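import Summits.CriticalPhenomena.SAWScalingLimit.Theorems.CriticalBubbleBound.Negative.CriticalBubbleBoundLatticeKernel

/-!
# Negative-side results for the crux `SAWTotalPositivity.CriticalBubbleBound` (stmt-CriticalPhenomena-7117):
load-bearing analysis: `IsBounded Ω` and `0 < δ` are idle (equivalent statement without them); dropping `u ∼ v` gives `sup_x G_{x_c}(0,x) < ∞` (work-file §2–§3).

Refuter `cdisprove` (standing adversary); the full indexed work file is
`Summits/CriticalPhenomena/SAWScalingLimit/Cruxes/CriticalBubbleBound/Disproof.lean`.
-/

noncomputable section

open MeasureTheory Filter Topology Set Function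
open Literature.Probability.LatticeModels Literature.Probability.Percolation
open Literature.Probability.RandomPlanarGeometry Literature.Probability.RandomPlanarGeometry.SAW
open Literature.Barriers.CriticalPhenomena.SupercriticalSAW
open scoped ENNReal NNReal BigOperators

namespace Summit.CriticalPhenomena.SAWScalingLimit.Theorems.CriticalBubbleBound.Negative

open Summit.CriticalPhenomena.SAWScalingLimit.Theses.SAWTotalPositivity (CriticalBubbleBound)

/-! ## §2 Load-bearing analysis: `IsBounded Ω` and `0 < δ` are idle -/

/-- The crux with BOTH side conditions on the domain dropped: all `Ω ⊆ ℂ`, all real `δ`. -/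
def CriticalBubbleBoundWithoutBoundedPos : Prop :=
  ∃ C : ℝ≥0∞, C ≠ ⊤ ∧ ∀ (Ω : Set ℂ) (δ : ℝ) (u v : Site 2), (zdGraph 2).Adj u v →
    SAW.weight Ω δ u v univ ≤ C

/-- **`IsBounded Ω` and `0 < δ` are NOT load-bearing**: dropping both gives an EQUIVALENT
statement (so no proof can use them in an essential way, and no disproof can exploit unbounded
domains, `δ ≤ 0`, or the junk conventions of `meshDomain` for infinite components — every
domain kernel is dominated by the lattice kernel, which the bounded disks already exhaust).
Consequently `_false_without_IsBounded` / `_false_without_pos` theorems are IMPOSSIBLE unless the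
crux itself is false. [folklore] -/
theorem criticalBubbleBound_iff_withoutBoundedPos :
    CriticalBubbleBound ↔ CriticalBubbleBoundWithoutBoundedPos := by
  rw [criticalBubbleBound_iff_latticeKernel]
  constructor
  · rintro ⟨C, hC, h⟩
    exact ⟨C, hC, fun Ω δ u v huv => (weight_univ_le_latticeKernel Ω δ u v).trans (h u v huv)⟩
  · rintro ⟨C, hC, h⟩
    refine ⟨C, hC, fun u v huv => latticeKernel_le_of_forall_unitDisk _ fun δ _ => ?_⟩
    rw [weightAt_criticalFugacity]; exact h unitDisk δ u v huv

/-! ## §3 Load-bearing analysis: dropping `u ∼ v` -/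

/-- The crux with the adjacency hypothesis dropped: a uniform bound over ALL pairs of sites. -/
def CriticalBubbleBoundWithoutAdj : Prop :=
  ∃ C : ℝ≥0∞, C ≠ ⊤ ∧ ∀ (Ω : Set ℂ) (δ : ℝ) (u v : Site 2), Bornology.IsBounded Ω → 0 < δ →
    SAW.weight Ω δ u v univ ≤ C

/-- Dropping `u ∼ v` gives `sup_x G_{x_c}(0,x) < ∞` — uniform boundedness of the whole critical
two-point function of `ℤ²`. [folklore] -/
theorem criticalBubbleBoundWithoutAdj_iff :
    CriticalBubbleBoundWithoutAdj ↔
      ∃ C : ℝ≥0∞, C ≠ ⊤ ∧ ∀ x : Site 2, latticeKernel criticalFugacity 0 x ≤ C := by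
  constructor
  · rintro ⟨C, hC, h⟩
    refine ⟨C, hC, fun x => latticeKernel_le_of_forall_unitDisk _ fun δ hδ => ?_⟩
    rw [weightAt_criticalFugacity]; exact h unitDisk δ 0 x isBounded_unitDisk hδ
  · rintro ⟨C, hC, h⟩
    refine ⟨C, hC, fun Ω δ u v _ _ => (weight_univ_le_latticeKernel Ω δ u v).trans ?_⟩
    rw [latticeKernel_eq_zero_sub]; exact h _

/-- The free strengthening implies the crux (trivially). STATUS: `CriticalBubbleBoundWithoutAdj`
is believed TRUE (the critical two-point function is expected to DECAY, `G_{x_c}(0,x) ≍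
|x|^{-5/24}`, so its supremum is attained near the origin) and is open exactly like the crux; it
is NOT refutable by any finite computation, and `u ∼ v` is therefore not load-bearing either —
it only fixes WHICH finite number the constant is. The diagonal value `K_{x_c}(u,u) = 1` (only
the trivial walk) shows the bound cannot be below `1` once `u = v` is allowed. [folklore] -/
theorem criticalBubbleBound_of_withoutAdj (h : CriticalBubbleBoundWithoutAdj) : CriticalBubbleBound := by
  obtain ⟨C, hC, h⟩ := h
  exact ⟨C, hC, fun Ω δ u v hΩ hδ _ => h Ω δ u v hΩ hδ⟩

end Summit.CriticalPhenomena.SAWScalingLimit.Theorems.CriticalBubbleBound.Negative
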